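import Summits.CriticalPhenomena.SAWScalingLimit.Theses.SAWLaplacianWalk

/-!
# Birth skeleton — crux `TipHarmonicLaw` (stmt-CriticalPhenomena-4480), route `SAWLaplacianWalk`

Crux (FIXED, rank 2 of `route-CriticalPhenomena-SAWLaplacianWalk`, concluded BY NAME by
`TipHarmonicLaw_of` below): the LATTICE Laplacian-5/8 law K58 — for every Dobrushin domain
`(Ω; a, b)`, endpoint approximation, third boundary point `d₀ ∉ {a, b}` with lattice approximations
`d_δ → d₀` joined to `a_δ`, and all `ρ, ε > 0`: for small `δ` there is ONE constant `C = C_δ` such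
that with `SAW.law`-probability `≥ 1 − ε`, EVERY prefix `η = γ[0, n]` (tip `w`) staying `ρ`-far
from `b` and `d₀` with `Z_η(d_δ) > 0` has

  `|log (Z_η(d_δ)/Z_η(b_δ)) − (5/8)·log (H_η(d_δ)/H_η(b_δ)) − C| ≤ ε`,

`Z_η(c)` = `x_c`-mass of SAW continuations from the tip to `c` avoiding the past, `H_η(c)` = the
simple-random-walk excursion probability from the tip to `c` in the same slit graph (both INLINED in
the route file; the `let Z … let H …` texts below are the route file's, character for character).

## The cut (two registered stubs): DETERMINISTIC LAW ON BOUNDARY-CLEAR PASTS + CLEARANCE IS TYPICAL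

Mechanism behind K58 (route header, WHY THIS LINE; Kennedy–Lawler lattice-effect picture).  In the
continuum the two-target identity is EXACT: for a slit domain `U = Ω ∖ η` with tip `w` and boundary
targets `b, d`, the SLE_{8/3} boundary partition function is covariant with exponent `5/8` at each
end and the excursion Poisson kernel with exponent `1` at each end, so
`Z^U(w,d)/Z^U(w,b) = (H^U(w,d)/H^U(w,b))^{5/8}` identically (in `ℍ`: `x^{-5/4} = (x^{-2})^{5/8}`),
whatever the geometry of the past — fjords, spirals and pinches included.  The LATTICE statement
K58 can therefore only fail through lattice-scale structure that the continuation feels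
DIFFERENTLY for the two targets:
 (i) the tip (always lattice-scale) — a common factor of `Z_η(b)`, `Z_η(d)` iff the tip factor is
     target-blind (the route's `TipForgetsTarget` / ratio-mixing content); likewise for `H`;
 (ii) the targets `b_δ`, `d_δ` — past-blind for `ρ`-far pasts, absorbed in the constant `C_δ`;
 (iii) lattice-scale contacts that SEPARATE the targets.  For a SIMPLE past in a SIMPLY CONNECTED
     domain a self-contact of `η` at its tip only closes DEAD-END pockets (the loop `η[m, n]` plus
     the contact gap bounds a pocket inside `Ω`; `b_δ, d_δ` are outside it because `η` is `ρ`-far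
     from `b, d₀`), so every extra door at the tip is a dead end and its return factor is
     target-blind; a contact of `η` with `∂Ω` at a boundary point `x` splits `Ω` along `η`, and it
     separates `d₀` from `b` iff `x` lies on the boundary arc met between them — never when `x` is
     near `a` ALONG THE BOUNDARY.  So the only enemy is a near-contact of the past with the FAR
     boundary arc `∂Ω ∖ (parameter-neighbourhood of a)`.
This is the refuter's objection made precise ("the worst-case-in-η form IS false (strip
eigenvalues)": a target-separating corridor of width `kδ` and aspect ratio `L` shifts
`log M − (5/8) log N` by `≍ L·(lattice correction at width k)`; for `H` the strip rate is
`arccosh`-exact with relative correction `O(1/k)`, for `Z` at `x_c` the CFT rate `(5/8)π/k` carries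
corrections `O(k^{-α})`).  A target-separating corridor must have `∂Ω` on one side; if the past
keeps distance `≥ δ^θ` from the far arc its width is `k δ ≥ δ^θ`, its aspect ratio is
`≤ diam Ω · δ^{-θ}`, and the shift is `≲ δ^{α(1−θ)−θ} → 0` as soon as `θ < α/(1+α)` (`θ < 1/2`
if `α = 1`).  Hence the two stubs, with the clearance exponent EXISTENTIAL in the deterministic
half and UNIVERSAL in the probabilistic half (typing checklist 4c(iv)):

* `stub_clearPastLaw` — **D, the deterministic two-target 5/8-law on boundary-clear pasts**
  (statement `ClearPastLaw`): `∃ θ ∈ (0,1)` such that for every `(Ω; a, b)`, endpoint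
  approximation, `d₀, d_δ` as in the crux and all `ρ, ε > 0` there is a parameter margin
  `τ ∈ (0, 1/2)` with: for all small `δ` ONE constant `C` serves EVERY self-avoiding walk `γ` of
  `Ω_δ` from `a_δ` to `b_δ` and every prefix of it that is `ρ`-far from `b, d₀`, keeps distance
  `≥ δ^θ` from the far arc `D.boundary '' [mark 0 + τ, mark 0 + 1 − τ]`, and has `Z_η(d_δ) > 0`:
  `|log (Z_η(d_δ)/Z_η(b_δ)) − (5/8) log (H_η(d_δ)/H_η(b_δ)) − C| ≤ ε`.  No probability: this is
  the analytic heart (tip target-blindness + the conformal identity + polynomial lattice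
  corrections), and it is EXACTLY what the route's cheapest falsifier computes (transfer-matrix
  evaluation of `Z`, one linear solve for `H`, on `L × L′` boxes, all clear pasts of length ≤ 6).
  Open-problem grade; not implied by the crux (it is uniform over atypical clear pasts) and does
  not imply it (it says nothing about pasts that graze the far arc).
* `stub_boundaryClearance` — **G, boundary clearance is typical** (statement `BoundaryClearance`):
  for every `(Ω; a, b)`, endpoint approximation, `τ ∈ (0,1/2)`, `θ ∈ (0,1)`, `ρ, ε > 0`, for all
  small `δ`: `SAW.law {γ has a vertex ρ-far from b within δ^θ of the far arc} ≤ ε`.  A pure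
  a-priori geometric estimate for the critical SAW (entropic repulsion from the boundary; by the
  exact lattice restriction property it is the partition-function continuity
  `Z_{Ω minus a δ^θ-collar of the far arc, outside B(b,ρ)} / Z_Ω → 1`; heuristic rate `δ^θ`
  from the boundary two-leg exponent `2` of SLE_{8/3}).  No `5/8`, no harmonic measure.  Open but
  of a different and softer kind than D; implied by neither the crux nor the summit as typed.

## Composition (PROVED, no `sorry` of its own): `TipHarmonicLaw_of`

Fix the data, take `θ` from D, then `τ` and the eventual constant `C` from D, and the eventual
clearance bound from G at `(τ, θ, ρ, ε)`.  On the intersection of the two eventualities the K58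
bad event is CONTAINED in G's event: a bad prefix is `ρ`-far with `Z_η(d_δ) > 0` and
`ε < |… − C|`, so by D (contrapositive) one of its vertices is within `δ^θ` of the far arc, and
that vertex is a vertex of `γ` (`support_takeUntil_subset_support`) which is `ρ`-far from `b`.
Monotonicity of `SAW.law` finishes.  Nothing is lost by the cut beyond the bet in D: G is what any
proof of K58 must control anyway (why-might-fail: "pinches of the past against ∂Ω between b and
d"), and D is K58 with the probability removed on the class where the strip obstruction cannot act.

## Calibration

* `ledger crux ls stmt-CriticalPhenomena-4480` (2026-08-17): no workfiles — no `Disproof.lean`, no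
  `_false_without_` theorem, no landed `Theorems/TipHarmonicLaw/Negative/*`; "Disproof used: none
  relevant" is literally true.  The refuter's route-review note (worst-case-in-`η` form false by
  strip eigenvalues) is honoured by the clearance hypothesis of D (see above) — D is NOT the
  worst-case form.
* Negatives index (`ledger negatives --problem CriticalPhenomena`, 11 entries): only
  stmt-CriticalPhenomena-0772 (all-`δ` tightness) concerns SAW laws; neither stub speaks of
  tightness, and every mesh quantifier here is eventual (`𝓝[>] 0`).  No stub is an instance of a
  refuted statement.
* Vacuity: D is not vacuous — the trivial prefix `{a_δ}` is clear for small `δ`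
  (`dist (a, far arc) > 0` since the boundary loop is simple, while `δ^θ → 0`) and `ρ`-far for
  small `ρ`, so D pins `C` to the unconditioned two-target log-ratio and asserts the law for every
  other clear far prefix; `Z_η(b_δ) > 0` and `H_η(b_δ), H_η(d_δ) > 0` hold along prefixes of
  actual walks (the suffix of `γ` is an admissible continuation; `H` is a sub-probability `tsum`).
  G is not vacuous (its event contains the grazing walks) and not trivially false (`τ < 1/2` keeps
  the far arc a genuine arc; vertices near `b` are exempted because `γ` ends at `b_δ`).

## Audit record (planner skeleton-register, 2026-08-17)

* `lean check --json birth.lean`: rc 0, errors [], `sorries = 2` = exactly `stub_clearPastLaw`,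
  `stub_boundaryClearance` (no other `sorry`); `#print axioms TipHarmonicLaw_of` =
  `[propext, Classical.choice, Quot.sound]` (no `sorryAx`: the composition is a real proof).
* `#h21_check_skeleton "stmt-CriticalPhenomena-4480" …SAWLaplacianWalk.TipHarmonicLaw
  stub_clearPastLaw stub_boundaryClearance` (scratch copy `bc/skelcheck.lean`): `ok = true`,
  `codes = []`, theorem `TipHarmonicLaw_of`, stubs resolved to the sorried theorems with signatures
  `ClearPastLaw` / `BoundaryClearance`, `sorries` = the two stubs.
* BC3 probes (folder `bc/probe_*.lean`; environment = the route file + the two statement `def`s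
  ONLY — no sorried stub and no composition in scope, since with them in scope everything including
  the crux itself is trivially "provable"): prescribed battery `first | exact? | simpa | aesop` at
  `maxHeartbeats 400000`, plain AND with the hypothesis introduced (`simpa using h`,
  `simpa [S] using h`): `ClearPastLaw → TipHarmonicLaw` FAIL (rc 1, "unsolved goals" after
  `aesop: failed to prove the goal after exhaustive search`; `exact?`/`simpa` find nothing; the
  widened battery with `simpa [ClearPastLaw] | (unfold ClearPastLaw; simpa)` dies at the heartbeat
  cap instead), `ClearPastLaw → SAWScalingLimit` FAIL (same), `BoundaryClearance → TipHarmonicLaw`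
  FAIL (unsolved goals / aesop exhaustive search failed, both forms),
  `BoundaryClearance → SAWScalingLimit` FAIL (same).  No stub is cheaply the crux or the summit:
  D lacks the probability (it needs G), G lacks the `5/8` (it needs D).

Namespace `…Cruxes.TipHarmonicLaw.Birth`; the statements use TREE VOCABULARY ONLY (route-file
`let`s verbatim, `MarkedDomain.boundary/mark`, `Metric.infDist`, `Real.rpow`), so each stub lands
verbatim as `Theorems/SAWLaplacianWalkTipHarmonicLaw<Stub>.lean --supports stmt-CriticalPhenomena-4480`
without importing this workfile.  Elaborated under the route file's `open` lines so that the
`Decidable` instances of the inlined `if`s — hence the terms — coincide with the crux's.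
-/

noncomputable section

namespace Summit.CriticalPhenomena.SAWScalingLimit.Cruxes.TipHarmonicLaw.Birth

open scoped BigOperators Topology Manifold Classical MeasureTheory ProbabilityTheory Matrix InnerProductSpace ComplexConjugate ContinuousMap
open Filter Set Function TopologicalSpace MeasureTheory
open Literature.Probability.RandomPlanarGeometry Literature.Probability.LatticeModels

/-! ### Stub statements -/

/-- **STUB D statement — `ClearPastLaw`**: the deterministic two-target `5/8`-law on boundary-clear,
`ρ`-far pasts.  There is a clearance exponent `θ ∈ (0,1)` such that for every Dobrushin domain,
endpoint approximation, third boundary point `d₀ ∉ {a,b}` with approximations `d_δ → d₀` joined to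
`a_δ`, and all `ρ, ε > 0`, there is a parameter margin `τ ∈ (0,1/2)` such that for all small `δ`
ONE constant `C` works for EVERY SAW `γ : a_δ → b_δ` of `Ω_δ` and every prefix `η = γ.takeUntil w`
whose vertices are `ρ`-far from `b = D.pt 1` and `d₀` and `δ^θ`-far from the far boundary arc
`D.boundary '' [D.mark 0 + τ, D.mark 0 + 1 − τ]` (the boundary minus a parameter-neighbourhood of
`a`), provided `Z_η(d_δ) > 0`:
`|log (Z_η(d_δ)/Z_η(b_δ)) − (5/8)·log (H_η(d_δ)/H_η(b_δ)) − C| ≤ ε`.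
`Z`, `H` are the route file's inlined slit SAW mass and slit SRW excursion probability. -/
def ClearPastLaw : Prop :=
  ∃ θ : ℝ, 0 < θ ∧ θ < 1 ∧
    ∀ (D : DobrushinDomain) (a b d : ℝ → Site 2) (d₀ : ℂ),
      let Z : ℝ → Site 2 → List (Site 2) → Site 2 → ℝ := fun δ w S c =>
        ∑' ω : SAW.DomainSAW D.carrier δ w c,
          if ∀ v ∈ ω.walk.support.tail, v ∉ S then SAW.criticalFugacity ^ ω.length else 0
      let H : ℝ → Site 2 → List (Site 2) → Site 2 → ℝ := fun δ w S c =>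
        ∑' ω : (discreteDomainGraph D.carrier δ).Walk w c,
          if (∀ v ∈ ω.support.tail, v ∉ S) ∧ c ∉ ω.support.dropLast then (1 / 4 : ℝ) ^ ω.length
          else 0
      SAW.IsEndpointApprox D a b → d₀ ∈ frontier D.carrier → d₀ ≠ D.pt 0 → d₀ ≠ D.pt 1 →
        Filter.Tendsto (fun δ => meshPoint δ (d δ)) (nhdsWithin 0 (Set.Ioi 0)) (nhds d₀) →
        (∀ᶠ δ in nhdsWithin 0 (Set.Ioi 0),
            (discreteDomainGraph D.carrier δ).Reachable (a δ) (d δ)) →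
        ∀ ρ ε : ℝ, 0 < ρ → 0 < ε → ∃ τ : ℝ, 0 < τ ∧ τ < 1 / 2 ∧
          ∀ᶠ δ in nhdsWithin 0 (Set.Ioi 0), ∃ C : ℝ,
            ∀ (γ : SAW.DomainSAW D.carrier δ (a δ) (b δ)) (w : Site 2) (hw : w ∈ γ.walk.support),
              (∀ v ∈ (γ.walk.takeUntil w hw).support,
                  ρ ≤ dist (meshPoint δ v) (D.pt 1) ∧ ρ ≤ dist (meshPoint δ v) d₀) →
              (∀ v ∈ (γ.walk.takeUntil w hw).support,
                  δ ^ θ ≤ Metric.infDist (meshPoint δ v)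
                    (D.boundary '' Set.Icc (D.mark 0 + τ) (D.mark 0 + 1 - τ))) →
              0 < Z δ w (γ.walk.takeUntil w hw).support (d δ) →
              |Real.log (Z δ w (γ.walk.takeUntil w hw).support (d δ) /
                    Z δ w (γ.walk.takeUntil w hw).support (b δ)) -
                  (5 / 8) * Real.log (H δ w (γ.walk.takeUntil w hw).support (d δ) /
                    H δ w (γ.walk.takeUntil w hw).support (b δ)) - C| ≤ ε

/-- **STUB G statement — `BoundaryClearance`**: boundary clearance is typical for the critical SAW.
For every Dobrushin domain, endpoint approximation, parameter margin `τ ∈ (0,1/2)`, exponent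
`θ ∈ (0,1)` and `ρ, ε > 0`, for all small `δ` the `SAW.law`-probability that the walk has a vertex
`ρ`-far from `b = D.pt 1` within distance `δ^θ` of the far boundary arc
`D.boundary '' [D.mark 0 + τ, D.mark 0 + 1 − τ]` is at most `ε`. -/
def BoundaryClearance : Prop :=
  ∀ (D : DobrushinDomain) (a b : ℝ → Site 2), SAW.IsEndpointApprox D a b →
    ∀ τ θ ρ ε : ℝ, 0 < τ → τ < 1 / 2 → 0 < θ → θ < 1 → 0 < ρ → 0 < ε →
      ∀ᶠ δ in nhdsWithin 0 (Set.Ioi 0),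
        SAW.law D.carrier δ (a δ) (b δ)
            {γ | ∃ v ∈ γ.walk.support, ρ ≤ dist (meshPoint δ v) (D.pt 1) ∧
              Metric.infDist (meshPoint δ v)
                  (D.boundary '' Set.Icc (D.mark 0 + τ) (D.mark 0 + 1 - τ)) < δ ^ θ} ≤
          ENNReal.ofReal ε

/-! ### The registered stubs (the ONLY `sorry`s of this file) -/

/-- **STUB D** (open; the analytic heart — tip target-blindness, the exact conformal two-target
identity `M = N^{5/8}`, polynomial lattice corrections above the clearance scale): the
deterministic two-target `5/8`-law on boundary-clear `ρ`-far pasts. -/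
theorem stub_clearPastLaw : ClearPastLaw := by
  sorry

/-- **STUB G** (open; a-priori SAW geometry — entropic repulsion of the critical SAW from the far
boundary arc at scale `δ^θ`, `θ < 1`): boundary clearance is typical. -/
theorem stub_boundaryClearance : BoundaryClearance := by
  sorry

/-! ### Name-keyed aliases — the hypotheses of `TipHarmonicLaw_of`

The native skeleton audit (`#h21_check_skeleton`, run by `ledger skeleton check`) admits a `Prop`
hypothesis of the skeleton theorem only if its head constant is a registered obligation or is NAMED
like a declared stub; `__Registered.stub_X` is the statement of `stub_X` under that name (device of
`Cruxes/AxiomsOfLimit/Lines/birth.lean` and `Cruxes/EventualTight/Lines/birth.lean`; the `__`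
namespace is an implementation detail, so the audit's stub report resolves each `stub_…` to the
sorried theorem above, not to the alias).  Each alias is `rfl`-equal to its statement. -/
namespace __Registered

/-- Alias of `ClearPastLaw` keyed by the registered stub name. -/
abbrev stub_clearPastLaw : Prop := ClearPastLaw
/-- Alias of `BoundaryClearance` keyed by the registered stub name. -/
abbrev stub_boundaryClearance : Prop := BoundaryClearance

end __Registered

/-! ### Composition (PROVED): the two stubs imply the crux, BY NAME -/

/-- **`TipHarmonicLaw` from the line `birth`** (kernel-checked, no `sorry` of its own).  Take the
clearance exponent `θ` of D, then D's parameter margin `τ` and eventual constant `C`, and G's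
eventual clearance bound at `(τ, θ, ρ, ε)`; on both eventualities the K58 bad event is contained in
G's event (contrapositive of D at a bad prefix, whose offending vertex is a vertex of `γ` that is
`ρ`-far from `b`), and `SAW.law` is monotone. -/
theorem TipHarmonicLaw_of (hD : __Registered.stub_clearPastLaw)
    (hG : __Registered.stub_boundaryClearance) :
    Summit.CriticalPhenomena.SAWScalingLimit.Theses.SAWLaplacianWalk.TipHarmonicLaw := by
  intro D a b d d₀
  dsimp only
  intro hab hd₀ hd₀a hd₀b hdlim hreach ρ ε hρ hε
  have hD' : ClearPastLaw := hD
  obtain ⟨θ, hθ0, hθ1, hDθ⟩ := hD'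
  have hDs := hDθ D a b d d₀
  dsimp only at hDs
  obtain ⟨τ, hτ0, hτ, hev⟩ := hDs hab hd₀ hd₀a hd₀b hdlim hreach ρ ε hρ hε
  have hG' : BoundaryClearance := hG
  have hGev := hG' D a b hab τ θ ρ ε hτ0 hτ hθ0 hθ1 hρ hε
  filter_upwards [hev, hGev] with δ hC hGδ
  obtain ⟨C, hC⟩ := hC
  refine ⟨C, le_trans (measure_mono ?_) hGδ⟩
  rintro γ ⟨w, hw, hfar, hZ, hbad⟩
  by_contra hgood
  have hclear : ∀ v ∈ (γ.walk.takeUntil w hw).support,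
      δ ^ θ ≤ Metric.infDist (meshPoint δ v)
        (D.boundary '' Set.Icc (D.mark 0 + τ) (D.mark 0 + 1 - τ)) := by
    intro v hv
    by_contra hlt
    exact hgood ⟨v, (γ.walk.support_takeUntil_subset_support hw) hv, (hfar v hv).1,
      lt_of_not_ge hlt⟩
  have hle := hC γ w hw hfar hclear hZ
  exact absurd (lt_of_lt_of_le hbad hle) (lt_irrefl _)

/-- Wiring check (an `example`, so that `TipHarmonicLaw_of` stays the only theorem concluding the
crux): the two sorried stubs feed the skeleton theorem as stated — this term becomes the crux proof
when the two `sorry`s above are discharged. -/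
example : Summit.CriticalPhenomena.SAWScalingLimit.Theses.SAWLaplacianWalk.TipHarmonicLaw :=
  TipHarmonicLaw_of stub_clearPastLaw stub_boundaryClearance

end Summit.CriticalPhenomena.SAWScalingLimit.Cruxes.TipHarmonicLaw.Birth

end
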